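import Mathlib

/-!
# The four-vertex mechanism behind the failure of the vdBHK (2006) mixed-graph conjecture, in
GENERAL weights: a closed form for the conditional covariance and its exact sign rule
(blind cell PercRepro2, lead)

`BHKMixedCounterexample.lean` and `BHKMixedCore.lean` (this cell) refute, by `decide +kernel` at
specific rational weights, the conjecture of van den Berg–Häggström–Kahn (Random Structures &
Algorithms 29 (2006), p. 18) that their Theorem 3.4 survives undirected edges.  This file proves the
MECHANISM symbolically.  The system is the root-inclusive core `K4`: vertices `s = 0`, `t = 1`,
`x = 2`, `y = 3`; arcs `s → x`, `x → s`, `t → y`, `y → t` and ONE undirected edge `{x, y}`, open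
independently with probabilities `A, A', B, B', E`; `R(v)` is the set of vertices reachable from `v`
by open oriented paths (`v ∈ R(v)`), `Q := {R(s) ∩ R(t) = ∅}`, `f := 1[x ∈ R(s)]` (increasing in
the `s`-cluster), `g := 1[y ∉ R(t)]` (decreasing in the `t`-cluster).  With the masses
`M_Q = P(Q)`, `M_f = E[f;Q]`, `M_g = E[g;Q]`, `M_fg = E[fg;Q]` as polynomials in the five weights,

  `M_Q · M_fg − M_f · M_g = A(1−A) · B(1−B) · E · [(1−A')(1−B') − (1−E)·A'·B']`,

so `Cov(f, g | Q) = (M_Q M_fg − M_f M_g)/M_Q²` is NEGATIVE exactly when `(1−E)·A'·B' > (1−A')(1−B')`: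
the forward arcs only scale the covariance, its sign is decided by the two return arcs and the
undirected edge (uniform weight `p`: `p² + p − 1 > 0`, i.e. `p > (√5 − 1)/2`).  The reachability is
computed on the `2^5` configurations by `decide`; the identity is then a polynomial identity.
(In the paper's own convention `v ∈ V(C_v)` needs an open edge at `v`; adding pendant arcs `s → s'`,
`t → t'` of probabilities `p_s, p_t` gives the same formula with `A' ↦ A'·p_s`, `B' ↦ B'·p_t` —
the six-vertex witness of `BHKMixedCore.lean` is the case of all weights `7/8`.)
-/

namespace Summit.Ventures.PercRepro2.BHKMixedCoreGeneral

/-- An edge of the mixed core: `arc = true` is the arc `u → v`, `arc = false` the undirected edge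
`{u, v}`. -/
structure MEdge where
  arc : Bool
  u : Nat
  v : Nat

/-- The five edges of `K4`: `0 = s → x`, `1 = x → s`, `2 = t → y`, `3 = y → t`, `4 = {x, y}`. -/
def edge : Nat → MEdge
  | 0 => ⟨true,  0, 2⟩
  | 1 => ⟨true,  2, 0⟩
  | 2 => ⟨true,  1, 3⟩
  | 3 => ⟨true,  3, 1⟩
  | _ => ⟨false, 2, 3⟩

/-- Edge `i` is open in the configuration `c ∈ [0, 32)` iff bit `i` of `c` is set. -/
def isOpen (c i : Nat) : Bool := c.testBit i

/-- Vertex sets are bitmasks over `0..3`. -/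
def mem (S x : Nat) : Bool := S.testBit x

/-- One expansion step along the open edges (arcs forward, the undirected edge both ways). -/
def step (c S : Nat) : Nat :=
  (List.range 5).foldl (fun S i =>
    let e := edge i
    if isOpen c i then
      let S₁ := if mem S e.u then S ||| (1 <<< e.v) else S
      if e.arc then S₁ else (if mem S₁ e.v then S₁ ||| (1 <<< e.u) else S₁)
    else S) S

/-- `n`-fold iteration of `step c`. -/
def iter (c : Nat) : Nat → Nat → Nat
  | 0, S => S
  | n + 1, S => iter c n (step c S)

/-- `R(v)`: the vertices reachable from `v` by open oriented paths, `v` included (four steps suffice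
on four vertices). -/
def reach (c v : Nat) : Nat := iter c 4 (1 <<< v)

/-- `Q = {R(s) ∩ R(t) = ∅}`. -/
def Q (c : Nat) : Bool := (reach c 0 &&& reach c 1) == 0
/-- `f = 1[x ∈ R(s)]`. -/
def f (c : Nat) : Bool := mem (reach c 0) 2
/-- `g = 1[y ∉ R(t)]`. -/
def g (c : Nat) : Bool := !(mem (reach c 1) 3)

/-- Product Bernoulli weight of the configuration `c`: `∏_i (w_i if edge i open else 1 − w_i)` with
`w = (A, A', B, B', E)` in the order of `edge`. -/
def wt (A A' B B' E : ℚ) (c : Nat) : ℚ :=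
  (if isOpen c 0 then A else 1 - A) * (if isOpen c 1 then A' else 1 - A') *
    (if isOpen c 2 then B else 1 - B) * (if isOpen c 3 then B' else 1 - B') *
    (if isOpen c 4 then E else 1 - E)

/-- `P(Q)`. -/
def massQ (A A' B B' E : ℚ) : ℚ :=
  ∑ c ∈ Finset.range 32, if Q c then wt A A' B B' E c else 0
/-- `E[f; Q]`. -/
def massfQ (A A' B B' E : ℚ) : ℚ :=
  ∑ c ∈ Finset.range 32, if Q c && f c then wt A A' B B' E c else 0
/-- `E[g; Q]`. -/
def massgQ (A A' B B' E : ℚ) : ℚ :=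
  ∑ c ∈ Finset.range 32, if Q c && g c then wt A A' B B' E c else 0
/-- `E[fg; Q]`. -/
def massfgQ (A A' B B' E : ℚ) : ℚ :=
  ∑ c ∈ Finset.range 32, if Q c && f c && g c then wt A A' B B' E c else 0

/-- The weights sum to one. -/
theorem total_mass (A A' B B' E : ℚ) : (∑ c ∈ Finset.range 32, wt A A' B B' E c) = 1 := by
  simp (config := {decide := true}) [Finset.sum_range_succ, wt, isOpen]
  ring

set_option maxRecDepth 16384

/-- `P(Q) = 1 − E + E·[(1−A)(1−A'B) + A(1−B)(1−B')]`. -/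
theorem massQ_eq (A A' B B' E : ℚ) :
    massQ A A' B B' E = 1 - E + E * ((1 - A) * (1 - A' * B) + A * (1 - B) * (1 - B')) := by
  simp (config := {decide := true}) [massQ, Finset.sum_range_succ, wt, isOpen, Q]
  ring

/-- `E[f; Q] = A·(1 − E + E(1−B)(1−B'))`. -/
theorem massfQ_eq (A A' B B' E : ℚ) :
    massfQ A A' B B' E = A * (1 - E + E * ((1 - B) * (1 - B'))) := by
  simp (config := {decide := true}) [massfQ, Finset.sum_range_succ, wt, isOpen, Q, f]
  ring

/-- `E[g; Q] = (1−B)·(1 − E·A·B')`. -/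
theorem massgQ_eq (A A' B B' E : ℚ) :
    massgQ A A' B B' E = (1 - B) * (1 - E * A * B') := by
  simp (config := {decide := true}) [massgQ, Finset.sum_range_succ, wt, isOpen, Q, g]
  ring

/-- `E[fg; Q] = A(1−B)·(1 − E·B')`. -/
theorem massfgQ_eq (A A' B B' E : ℚ) :
    massfgQ A A' B B' E = A * (1 - B) * (1 - E * B') := by
  simp (config := {decide := true}) [massfgQ, Finset.sum_range_succ, wt, isOpen, Q, f, g]
  ring

/-- THE CLOSED FORM: `M_Q · M_fg − M_f · M_g = A(1−A)·B(1−B)·E·[(1−A')(1−B') − (1−E)A'B']`. -/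
theorem covariance_numerator (A A' B B' E : ℚ) :
    massQ A A' B B' E * massfgQ A A' B B' E - massfQ A A' B B' E * massgQ A A' B B' E =
      A * (1 - A) * (B * (1 - B)) * E * ((1 - A') * (1 - B') - (1 - E) * (A' * B')) := by
  rw [massQ_eq, massfQ_eq, massgQ_eq, massfgQ_eq]; ring

/-- The sign rule: for `A, B, E ∈ (0, 1)` and `A', B' ≤ 1` the conditional covariance is negative iff
`(1−E)·A'·B' > (1−A')(1−B')`. -/
theorem covariance_neg_iff (A A' B B' E : ℚ) (hA : 0 < A) (hA1 : A < 1) (hB : 0 < B) (hB1 : B < 1)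
    (hE : 0 < E) (hE1 : E < 1) (hA'1 : A' ≤ 1) (hB'1 : B' ≤ 1) :
    massfgQ A A' B B' E / massQ A A' B B' E
        < (massfQ A A' B B' E / massQ A A' B B' E) * (massgQ A A' B B' E / massQ A A' B B' E)
      ↔ (1 - A') * (1 - B') < (1 - E) * (A' * B') := by
  have hQ : 0 < massQ A A' B B' E := by
    rw [massQ_eq]
    have h1 : 0 ≤ (1 - A) * (1 - A' * B) := by
      apply mul_nonneg (by linarith)
      nlinarith [mul_le_mul_of_nonneg_right hA'1 hB.le]
    have h2 : 0 ≤ A * (1 - B) * (1 - B') := by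
      apply mul_nonneg (mul_nonneg hA.le (by linarith)) (by linarith)
    nlinarith [mul_nonneg hE.le (add_nonneg h1 h2)]
  have hpos : 0 < A * (1 - A) * (B * (1 - B)) * E := by
    apply mul_pos (mul_pos (mul_pos hA (by linarith)) (mul_pos hB (by linarith))) hE
  have hcov : massfgQ A A' B B' E / massQ A A' B B' E
      - (massfQ A A' B B' E / massQ A A' B B' E) * (massgQ A A' B B' E / massQ A A' B B' E)
      = (massQ A A' B B' E * massfgQ A A' B B' E - massfQ A A' B B' E * massgQ A A' B B' E)
          / (massQ A A' B B' E * massQ A A' B B' E) := by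
    field_simp
  rw [← sub_neg, hcov, div_lt_iff₀ (mul_pos hQ hQ), zero_mul, covariance_numerator]
  constructor
  · intro h
    rcases mul_neg_iff.1 h with ⟨_, hb⟩ | ⟨ha, _⟩
    · linarith
    · linarith
  · intro h
    exact mul_neg_of_pos_of_neg hpos (by linarith)

/-- Uniform weight `p`: the numerator is `−p³(1−p)³(p² + p − 1)`, negative iff `p² + p > 1`. -/
theorem uniform_numerator (p : ℚ) :
    massQ p p p p p * massfgQ p p p p p - massfQ p p p p p * massgQ p p p p p =
      -(p ^ 3 * (1 - p) ^ 3 * (p ^ 2 + p - 1)) := by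
  rw [covariance_numerator]; ring

end Summit.Ventures.PercRepro2.BHKMixedCoreGeneral
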